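/-
COR-CM (cell pub-hodgecm2, stage 2 of the Hodge ladder) — count-neutral KERNEL CENSUS → TREE TRANSPORT of the faithful full EVEN
slice (seat prover-pub-hodgecm2-b23-g37-0, binder prover b23, gen 37; claim EVEN-SLICE F3, HOME/INBOX.md 2026-08-22T13:48Z; sequel of
`Census/EvenSliceFacesGenerate.lean` and of the seat's gen-36 `CorCM/FaceCensusOddSliceClosed.lean`).  Theorems only: the seat's
generation theorem for `|A|` even (`Census/EvenSliceFacesGenerate.lean` `hodge_le_pairs_sup_span_squares_of_even`, `card_squares_add_one`)
and seat b09's canonical squares (`Census/OddSliceFacesDescent.lean` `squares`, `squares_places`) are fed BY NAME into the sockets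
`exists_faceSet_of_oddSlice` and `…_of_exists_facePeriod_of_oddSlice_aut` of `CorCM/FaceCensusOddSliceClosed.lean` — which never used
the parity of `|A|`; nothing of b09's is restated or re-filed; no definition, no named fact, nothing asserted; `Interfaces.lean` (C1),
every E term, B01 and `Transposition/*` are untouched.
HONEST FRAMING (COORDINATOR RULING — HODGE FRAMING CORRECTION, 2026-08-21T11:55:35Z): `HC_CM` is NOT proved, here or anywhere in
the tree.  Every theorem below says, for ONE Galois CM field `K`: a finite set of rank-four faces of `K`, FEWER than the number of
isogeny classes of simple CM abelian varieties other than `E` split by `K`, EXISTS whose face periods on the universe of record would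
imply the Hodge conjecture for the abelian varieties generated by `K`; no period is produced and nothing is discharged for any field.
T5 (coordinator ruling 15:33:56Z (3)): binder sets = {dictionary datum (transport of structure / `Aut(K)`), `|A|` even `≥ 4`, face
periods on the produced set = instances of the crux (`FacePeriodExists` / B01-S) with no `¬` theorem in the tree on the universe of
record}; the generation hypothesis of the gen-36 sockets is now a THEOREM (part F2) and the face readings are inhabited
(`FaceCensus.OddSlice.exists_faces_read`) — no contradiction derivable; checker: self (prover-pub-hodgecm2-b23-g37-0), 2026-08-22.
-/
import Summits.HodgeConjecture.CorCM.FaceCensusOddSliceClosed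
import Summits.HodgeConjecture.CorCM.Census.EvenSliceFacesGenerate
import HarnessLib

/-!
# The faithful full EVEN slice, transported: `#OrbitsA A − 1` face periods per field suffice (group `ℤ/2 × A`, `|A|` even)

(NOT a twin of `Census/OddSliceFaceTransport.lean`: that file instantiates the odd-slice transport with seat b09's family of
`#OrbitsA A` faces for `|A|` ODD; this file instantiates the same sockets with the canonical squares alone — `#OrbitsA A − 1` faces —
for `|A|` EVEN, where part F2 shows that no closing face is needed.)

Setting: `K` a Galois CM field whose group of Galois translates is `ℤ/2 × A` with complex conjugation `(1, 0)` and `|A|` EVEN `≥ 4`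
— the composita `k·F₀` of an imaginary quadratic field `k` with a totally real abelian field `F₀` of even degree `≥ 4`; every
cyclotomic field `ℚ(ζ_N)` with `4 ∣ N`, `N ≥ 16` (`Gal = (ℤ/N)ˣ`, `c = −1 ∉ Gal²`); `ℚ(ζ_N)` for `N` odd with a prime factor
`≡ 3 (mod 4)` and `φ(N)/2` even (`N = 15, 21, 33, 35, 39, …`).  (The cyclic CM fields of degree `≡ 0 (mod 4)` are NOT of this shape:
there complex conjugation is a square.)

* §1 `exists_faceSet_evenSliceSquares` (dictionary datum `θ` on `GalT K`) and `…_aut` (a bijection `ε : Aut(K) ≃ ℤ/2 × A`,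
  multiplicative-to-additive, carrying the conjugation at `σ₀` to `(1,0)`): there is a finite set `𝒮` of rank-four faces of `K` with
  `|𝒮| + 1 ≤ #OrbitsA A` (`#OrbitsA A` = the number of isogeny classes of simple CM abelian varieties other than the CM elliptic curve
  `E` split by `K`) such that ONE period witness per face of `𝒮` on the universe of record implies the Hodge conjecture, in every
  codimension, for every complex abelian variety dominated by a finite product of abelian varieties realising CM types of CM fields
  embeddable in `K`.  By seat b09's parity floor (`CorCM/FaceParityFloor.lean`) no generating face set of such a field has fewer than
  `#OrbitsA A − 1` members, so the produced set is of the least possible size: `3, 2, 6, 18, 22, 28, 54, 178, 188` for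
  `A = (ℤ/2)², ℤ/4, ℤ/6, ℤ/8, ℤ/2 × ℤ/4, (ℤ/2)³, ℤ/10, ℤ/12, ℤ/2 × ℤ/6`.

No Cayley table, no bitmask, no certificate, no `decide`.  `HC_CM` is NOT proved; nothing here produces a period.

References: [cite: Pohlmann1968, Thm. 1]; [cite: Milne1999LefschetzClasses, Thm. 3.2 and Cor. 4.5];
[cite: Shimura1998, §6.2 Theorem 3 and §6.1 Corollary of Theorem 2 (pp. 41–43)]; [cite: MumfordAV1970, §19 Thm. 1 and p. 169].
-/

noncomputable section

open CategoryTheory NumberField NumberField.ComplexEmbedding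
open Literature.AlgebraicGeometry Literature.AlgebraicGeometry.Motives Literature.AlgebraicGeometry.HodgeTheory
open Literature.AlgebraicGeometry.ComplexMultiplication Literature.AlgebraicGeometry.Milne1999
open Literature.NumberTheory.Automorphic
open Literature.NumberTheory.Automorphic.PicardCM
open Summit.HodgeConjecture.CorCM.Domination

namespace Summit.HodgeConjecture.CorCM

open Summit.HodgeConjecture.CorCM.Census.OddSliceFacesModel (Ty tw transl δ pairVec pairs hodge)
open Summit.HodgeConjecture.CorCM.Census.OddSliceFacesSquares (faceVec)
open Summit.HodgeConjecture.CorCM.Census.OddSliceFacesDescent (squares squares_places)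
open Summit.HodgeConjecture.CorCM.Census.EvenSliceFacesGenerate (hodge_le_pairs_sup_span_squares_of_even card_squares_add_one)
open Summit.HodgeConjecture.CorCM.Census.OddDegreeParityLaw (OrbitsA)
open Summit.HodgeConjecture.CorCM.FaceCensus.OddSlice

/-! ## §1 The faithful full even slice through the transport -/

section Squares

variable {A : Type} [AddCommGroup A] [Fintype A] [DecidableEq A]

/-- **THE FAITHFUL FULL EVEN SLICE, TRANSPORTED (dictionary datum on `GalT K`).**  `K` a Galois CM field with
`θ : GalT K ≃ ℤ/2 × A` (multiplicative-to-additive, `conjT ↦ (1,0)`), `|A|` even `≥ 4`, `σ₀` a base embedding: there is a finite set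
`𝒮` of rank-four faces of `K` with `|𝒮| + 1 ≤ #OrbitsA A` — one reading each canonical square of seat b09's model — such that ONE
period witness per face of `𝒮` on the universe of record implies the Hodge conjecture, in every codimension, for every complex abelian
variety dominated by a finite product of abelian varieties realising CM types of CM fields embeddable in `K`.  (FRAMING: existence
of the face set + a conditional; `HC_CM` is not proved, no period is produced.)
[cite: Shimura1998, §6.2 Theorem 3 and §6.1 Corollary of Theorem 2 (pp. 41–43)] [cite: Pohlmann1968, Thm. 1]
[cite: Milne1999LefschetzClasses, Thm. 3.2 and Cor. 4.5] [cite: MumfordAV1970, §19 Thm. 1 and p. 169] -/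
theorem exists_faceSet_evenSliceSquares (K : CMField) [hGal : IsGalois ℚ K] (hA : Even (Fintype.card A))
    (h4 : 4 ≤ Fintype.card A) (θ : GalT K ≃ ZMod 2 × A) (hθ : ∀ P Q : GalT K, θ (P * Q) = θ P + θ Q) (hc : θ conjT = (1, 0))
    (σ₀ : (K : Type) →+* ℂ) :
    ∃ 𝒮 : Finset (Face K), 𝒮.card + 1 ≤ Fintype.card (OrbitsA A) ∧
      ((∀ f ∈ 𝒮, ∃ ι₁ : K →+* ℂ, f.Admissible ι₁ ∧ ∃ (V : HermSpace3 K ι₁) (σ : K →+* ℂ),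
        (Model.picardCMUniverse exists_isReal_hodgeModel_holds hodgePQ_independent_of_hodgeModel_holds
          BallQuotient.ballQuotientUniformised_holds cmAbelianVarietyRealised_holds).PeriodNV ι₁ V K f.psi σ) →
      ∀ {P B : AbelianVariety ℂ}, AbelianVariety.IsProductOf (fun B : AbelianVariety ℂ =>
        ∃ (E : Type) (_ : Field E) (_ : NumberField E) (_ : IsCMField E) (_ : E →+* (K : Type)) (Φ : CMType E)
          (ι : 𝓞 E →+* End B) (θ : E →+* Module.End ℂ (complexBetti B.X 1)),
          IsCMTypeRealisation Φ B ι θ) P →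
      AVDominatedBy B P → HodgeConjectureFor B.dim B.X) := by
  obtain ⟨𝒮, hcard, h⟩ := exists_faceSet_of_oddSlice K (by omega) θ hθ hc (squares A) (fun s hs => squares_places A hs)
    (hodge_le_pairs_sup_span_squares_of_even A hA) σ₀
  refine ⟨𝒮, ?_, h⟩
  have := card_squares_add_one A (by omega : 1 < Fintype.card A)
  omega

/-- **THE FAITHFUL FULL EVEN SLICE, TRANSPORTED (`Aut`-datum).**  Same conclusion from a bijection `ε : Aut(K) ≃ ℤ/2 × A` (`|A|`
even `≥ 4`), multiplicative-to-additive, carrying the automorphism inducing complex conjugation at `σ₀` to `(1, 0)` — e.g.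
`K = k·F₀` with `ε = (restriction to k, restriction to F₀)`.
[cite: Shimura1998, §6.2 Theorem 3 and §6.1 Corollary of Theorem 2 (pp. 41–43)] [cite: Pohlmann1968, Thm. 1]
[cite: Milne1999LefschetzClasses, Thm. 3.2 and Cor. 4.5] [cite: MumfordAV1970, §19 Thm. 1 and p. 169] -/
theorem exists_faceSet_evenSliceSquares_aut (K : CMField) [hGal : IsGalois ℚ K] (hA : Even (Fintype.card A))
    (h4 : 4 ≤ Fintype.card A) (σ₀ : (K : Type) →+* ℂ) (ε : ((K : Type) ≃ₐ[ℚ] (K : Type)) ≃ ZMod 2 × A)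
    (hε : ∀ x y : ((K : Type) ≃ₐ[ℚ] (K : Type)), ε (x * y) = ε x + ε y)
    {c : ((K : Type) ≃ₐ[ℚ] (K : Type))} (hcσ : σ₀.comp (c : (K : Type) →+* (K : Type)) = conjugate σ₀) (hεc : ε c = (1, 0)) :
    ∃ 𝒮 : Finset (Face K), 𝒮.card + 1 ≤ Fintype.card (OrbitsA A) ∧
      ((∀ f ∈ 𝒮, ∃ ι₁ : K →+* ℂ, f.Admissible ι₁ ∧ ∃ (V : HermSpace3 K ι₁) (σ : K →+* ℂ),
        (Model.picardCMUniverse exists_isReal_hodgeModel_holds hodgePQ_independent_of_hodgeModel_holds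
          BallQuotient.ballQuotientUniformised_holds cmAbelianVarietyRealised_holds).PeriodNV ι₁ V K f.psi σ) →
      ∀ {P B : AbelianVariety ℂ}, AbelianVariety.IsProductOf (fun B : AbelianVariety ℂ =>
        ∃ (E : Type) (_ : Field E) (_ : NumberField E) (_ : IsCMField E) (_ : E →+* (K : Type)) (Φ : CMType E)
          (ι : 𝓞 E →+* End B) (θ : E →+* Module.End ℂ (complexBetti B.X 1)),
          IsCMTypeRealisation Φ B ι θ) P →
      AVDominatedBy B P → HodgeConjectureFor B.dim B.X) := by
  obtain ⟨hθ, hc⟩ := autDatum σ₀ ε hε hcσ hεc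
  exact exists_faceSet_evenSliceSquares K hA h4 ((galTOfAut σ₀).symm.trans ε) hθ hc σ₀

/-- **The explicit-face form (dictionary datum).**  Under the same datum, for ANY set `𝒮` of faces of `K` reading the canonical squares
of seat b09's model at `σ₀` (one face `R` per square `(φ; i, j)`: `typeMap θ (pullType R.Φ σ₀) = φ`, `(θ (translate σ₀ R.p)).2 = i`,
`(θ (translate σ₀ R.p′)).2 = j`), ONE period witness per face of `𝒮` implies the Hodge conjecture for every complex abelian variety
dominated by a finite product of abelian varieties realising CM types of CM fields embeddable in `K`.  (FRAMING: conditional;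
`HC_CM` is not proved.)
[cite: Shimura1998, §6.2 Theorem 3 and §6.1 Corollary of Theorem 2 (pp. 41–43)] [cite: Pohlmann1968, Thm. 1]
[cite: Milne1999LefschetzClasses, Thm. 3.2 and Cor. 4.5] [cite: MumfordAV1970, §19 Thm. 1 and p. 169] -/
theorem hodgeConjectureFor_of_avDominatedBy_isProductOf_of_exists_facePeriod_of_evenSliceSquares (K : CMField)
    [hGal : IsGalois ℚ K] (hA : Even (Fintype.card A)) (h4 : 4 ≤ Fintype.card A)
    (θ : GalT K ≃ ZMod 2 × A) (hθ : ∀ P Q : GalT K, θ (P * Q) = θ P + θ Q) (hc : θ conjT = (1, 0))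
    (σ₀ : (K : Type) →+* ℂ) (𝒮 : Set (Face K))
    (hreads : ∀ s ∈ squares A, ∃ R ∈ 𝒮, typeMap θ (pullType R.Φ σ₀) = s.1 ∧ (θ (translate σ₀ R.p)).2 = s.2.1 ∧
      (θ (translate σ₀ R.p')).2 = s.2.2)
    (h : ∀ f ∈ 𝒮, ∃ ι₁ : K →+* ℂ, f.Admissible ι₁ ∧ ∃ (V : HermSpace3 K ι₁) (σ : K →+* ℂ),
      (Model.picardCMUniverse exists_isReal_hodgeModel_holds hodgePQ_independent_of_hodgeModel_holds
        BallQuotient.ballQuotientUniformised_holds cmAbelianVarietyRealised_holds).PeriodNV ι₁ V K f.psi σ)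
    {P B : AbelianVariety ℂ} (hP : AbelianVariety.IsProductOf (fun B : AbelianVariety ℂ =>
      ∃ (E : Type) (_ : Field E) (_ : NumberField E) (_ : IsCMField E) (_ : E →+* (K : Type)) (Φ : CMType E)
        (ι : 𝓞 E →+* End B) (θ : E →+* Module.End ℂ (complexBetti B.X 1)),
        IsCMTypeRealisation Φ B ι θ) P)
    (hB : AVDominatedBy B P) : HodgeConjectureFor B.dim B.X :=
  hodgeConjectureFor_of_avDominatedBy_isProductOf_of_exists_facePeriod_of_oddSlice K (by omega) θ hθ hc (squares A)
    (hodge_le_pairs_sup_span_squares_of_even A hA) σ₀ 𝒮 hreads h hP hB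

end Squares

end Summit.HodgeConjecture.CorCM

end
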